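import Mathlib
import HarnessLib
import Summits.HubbardSuperconductivity.HubbardSuperconductivity.Theorems.KLProgrammeKLRegimeEngineTowerLevFloorUnitsDefs
import Summits.HubbardSuperconductivity.HubbardSuperconductivity.Theorems.KLProgrammeKLRegimeEngineTowerInstRemeasureLevBase

/-!
# Route `KLProgramme` — crux K3 ENGINE (stmt-HubbardSuperconductivity-20437 `KLRegimeEngineV17F2`), stub (b) v2, THE LEVELS PACKAGE (ℓ), instantiation (I2):
# THE RE-BASED `hμ` SUMMANDS IN FLOOR-KEYED KIT UNITS («R-rows-F», cures (A″) «(ℓ)-BLOCK0-LOGM» + (ε) «(ℓ)-LEV-ODD»; cell gate-hubbard-kl, seat p4 g19)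

Floor-keyed twin of …TowerInstRemeasureLevBase: the absolute re-based row `klTowerMeasLev_le_base_add_sum_bornLev_klEng_uniform` (…TowerRemeasureLevBase, unit-free)
divided by the FLOOR unit `klLevUnitF … t p (dk−1)` of …TowerLevFloorUnitsDefs (k3c2-p3 p668906) instead of the half-keyed `klLevUnit`.  The jump factor of one
family step `2^{2p−2−t}` over the floor ratio `klLevRatioF t p = 8^p/(32·2^{klLevGain t})` is the pure gain `(2^{p + t − klLevGain t − 3})⁻¹` (`klLevGain t ≤ t`,
so the floor exponent `p + t − klLevGain t − 3` is at least the half one `(2p + t − 6)/2`): the rate is `(2^d)⁻¹` per block where the half-keyed rows had `((√2)^d)⁻¹`.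

* §1 `klLevGain_le`, `klLevRatioF_jump_identity`, `jump_div_klLevRatioF_eq`, `two_pow_mul_inv_pow_eq_F`;
* §2 `bornSummandF_div_klLevUnitF_eq`, `baseSummandF_div_klLevUnitF_eq`;
* §3 **`klTowerMuLevAtF_le_kitSum_base`** — for `d ≥ 2`, `k ≥ 2`, every track `t`, `t + 2 ≤ 2p`, `3 ≤ p`, with `e_F = p + t − klLevGain t − 3`:
  `klTowerMuLevAtF … d t k p ≤ 27^{t+1}·C₁C₂^{2p−1}·( ((2^{e_F})⁻¹)^{d(k−1)}·N_b/unitF_t(p,d−1) + Σ_{1≤k′<k} 2^{e_F}·((2^d)⁻¹)^{e_F(k−k′)}·klTowerBLevF … d t (k′+1) p )`.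
Compositions of landed theorems and real algebra; nothing about the model is asserted beyond them; nothing asserts (ℓ), any stub, K3 or superconductivity.
References: BGM 2006 §2.8 (2.83), (2.93)–(2.98), Lemma 2.5 [cite: BenfattoGiulianiMastropietro2006].
-/

noncomputable section

namespace Summit.HubbardSuperconductivity.HubbardSuperconductivity.Theorems.EngineV8

set_option linter.dupNamespace false -- summit = problem name (single-conjunct summit), D-0017

open Classical
open Real Finset Literature.MathematicalPhysics.QuantumLattice Literature.Probability.LatticeModels GrassmannAlgebra
open Literature.MathematicalPhysics.QuantumLattice.FermiRG
open Summit.HubbardSuperconductivity.HubbardSuperconductivity.Theorems.KLProgrammeLegKernels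
open Summit.HubbardSuperconductivity.HubbardSuperconductivity.Theorems.KLRegimeSplit
open Summit.HubbardSuperconductivity.HubbardSuperconductivity.Theorems.KLRegimeWick
open Summit.HubbardSuperconductivity.HubbardSuperconductivity.Theorems.TorusFourierL2
open Summit.HubbardSuperconductivity.HubbardSuperconductivity.Theorems.DispersionFlow
open Summit.HubbardSuperconductivity.HubbardSuperconductivity.Theorems.PerturbedFermiCurve

/-! ## §1 Powers of `2`: the jump factor against the floor unit ratio -/

/-- `klLevGain t ≤ t` (`⌊t/2⌋ ∧ 2 ≤ t`). -/
theorem klLevGain_le (t : Fin 5) : klLevGain t ≤ (t : ℕ) := by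
  unfold klLevGain levelGainExp
  have := t.isLt
  omega

/-- **The floor jump/unit identity**: `2^{2p−2−t}·32·2^{g}·2^{p+t−g−3} = 8^p` for `g = klLevGain t`, `t + 2 ≤ 2p`, `3 ≤ p`. -/
theorem klLevRatioF_jump_identity {p : ℕ} (t : Fin 5) (h1 : (t : ℕ) + 2 ≤ 2 * p) (h3 : 3 ≤ p) :
    (2 : ℝ) ^ (2 * p - 2 - (t : ℕ)) * 32 * (2 : ℝ) ^ klLevGain t * (2 : ℝ) ^ (p + (t : ℕ) - klLevGain t - 3) = 8 ^ p := by
  have hg := klLevGain_le t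
  have h32 : (32 : ℝ) = 2 ^ 5 := by norm_num
  have h8 : (8 : ℝ) ^ p = 2 ^ (3 * p) := by rw [pow_mul]; norm_num
  rw [h32, h8, ← pow_add, ← pow_add, ← pow_add]
  congr 1
  omega

/-- **The floor jump factor over the floor unit ratio is a pure gain**: `2^{2p−2−t} / klLevRatioF t p = (2^{p+t−klLevGain t−3})⁻¹` (`t + 2 ≤ 2p`, `3 ≤ p`). -/
theorem jump_div_klLevRatioF_eq {p : ℕ} (t : Fin 5) (h1 : (t : ℕ) + 2 ≤ 2 * p) (h3 : 3 ≤ p) :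
    (2 : ℝ) ^ (2 * p - 2 - (t : ℕ)) / klLevRatioF t p = ((2 : ℝ) ^ (p + (t : ℕ) - klLevGain t - 3))⁻¹ := by
  have hid := klLevRatioF_jump_identity t h1 h3
  unfold klLevRatioF
  have h8 : (0 : ℝ) < 8 ^ p := by positivity
  have hg0 : (0 : ℝ) < 2 ^ klLevGain t := by positivity
  have he0 : (0 : ℝ) < 2 ^ (p + (t : ℕ) - klLevGain t - 3) := by positivity
  field_simp
  linear_combination hid

/-- `2^e·((2^d)⁻¹)^e = ((2^{d−1})⁻¹)^e` for `1 ≤ d`. -/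
theorem two_pow_mul_inv_pow_eq_F {d : ℕ} (hd : 1 ≤ d) (e : ℕ) :
    (2 : ℝ) ^ e * (((2 : ℝ) ^ d)⁻¹) ^ e = (((2 : ℝ) ^ (d - 1))⁻¹) ^ e := by
  rw [← mul_pow]
  congr 1
  obtain ⟨d', rfl⟩ : ∃ d', d = d' + 1 := ⟨d - 1, by omega⟩
  rw [Nat.add_sub_cancel, pow_succ]
  field_simp

variable {L M : ℕ} [NeZero L] [NeZero M]

/-! ## §2 The summands in floor units -/

/-- **One born summand in floor kit units, rate form**: for `k′ < k`, `1 ≤ d`, `F = t + 1`, `t + 2 ≤ 2p`, `3 ≤ p`, `e_F = p + t − klLevGain t − 3`,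
`(2^{dk−1−dk′})^{2p−1−F}·klTowerBornLev … d k′ (2p) F / klLevUnitF … t p (dk−1) = 2^{e_F}·((2^d)⁻¹)^{e_F(k−k′)}·klTowerBLevF … d t (k′+1) p`. -/
theorem bornSummandF_div_klLevUnitF_eq {β : ℝ} (hβ : 0 < β) (U μ : ℝ) (K : TrigPolyC4v) {d k k' p : ℕ} (hd : 1 ≤ d) (hk : k' < k)
    (t : Fin 5) (h1 : (t : ℕ) + 2 ≤ 2 * p) (h3 : 3 ≤ p) :
    ((2 : ℝ) ^ (d * k - 1 - d * k')) ^ (2 * p - 1 - ((t : ℕ) + 1)) * klTowerBornLev L M β U μ K d k' (2 * p) ((t : ℕ) + 1) /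
        klLevUnitF β M t p (d * k - 1) =
      (2 : ℝ) ^ (p + (t : ℕ) - klLevGain t - 3) * (((2 : ℝ) ^ d)⁻¹) ^ ((p + (t : ℕ) - klLevGain t - 3) * (k - k')) *
        klTowerBLevF L M β U μ K d t (k' + 1) p := by
  have hu0 : 0 < klLevUnitF β M t p (d * k') := klLevUnitF_pos hβ t p _
  have hr0 : 0 < klLevRatioF t p := klLevRatioF_pos t p
  obtain ⟨Δ, hΔ⟩ : ∃ Δ : ℕ, d * k - 1 = d * k' + Δ := ⟨d * k - 1 - d * k', by
    have : d * k' + d ≤ d * k := by rw [← Nat.mul_succ]; exact Nat.mul_le_mul_left d hk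
    omega⟩
  have hΔ1 : Δ + 1 = d * (k - k') := by
    have : d * (k - k') = d * k - d * k' := Nat.mul_sub d k k'
    have : d * k' + d ≤ d * k := by rw [← Nat.mul_succ]; exact Nat.mul_le_mul_left d hk
    omega
  have hΔ' : d * k - 1 - d * k' = Δ := by omega
  rw [hΔ', hΔ, klLevUnitF_add, klTowerBLevF_succ, show 2 * p - 1 - ((t : ℕ) + 1) = 2 * p - 2 - (t : ℕ) by omega, ← pow_mul,
    mul_comm Δ, pow_mul]
  rw [show ((2 : ℝ) ^ (2 * p - 2 - (t : ℕ))) ^ Δ * klTowerBornLev L M β U μ K d k' (2 * p) ((t : ℕ) + 1) /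
      (klLevUnitF β M t p (d * k') * klLevRatioF t p ^ Δ) =
      ((2 : ℝ) ^ (2 * p - 2 - (t : ℕ)) / klLevRatioF t p) ^ Δ * (klTowerBornLev L M β U μ K d k' (2 * p) ((t : ℕ) + 1) / klLevUnitF β M t p (d * k')) by
    rw [div_pow]; field_simp]
  rw [jump_div_klLevRatioF_eq t h1 h3, inv_pow_eq_mul_inv_pow_succ (by positivity) Δ, hΔ1, ← inv_pow, ← pow_mul, ← inv_pow, ← pow_mul]
  congr 3
  ring

omit [NeZero L] in
/-- **The base summand in floor kit units**: for `1 ≤ d`, `1 ≤ k`, `e_F = p + t − klLevGain t − 3`,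
`(2^{(dk−1)−(d−1)})^{2p−1−F}·N_b / klLevUnitF … t p (dk−1) = ((2^{e_F})⁻¹)^{d(k−1)}·(N_b / klLevUnitF … t p (d−1))`. -/
theorem baseSummandF_div_klLevUnitF_eq {β : ℝ} (hβ : 0 < β) {d k p : ℕ} (hd : 1 ≤ d) (hk : 1 ≤ k) (t : Fin 5)
    (h1 : (t : ℕ) + 2 ≤ 2 * p) (h3 : 3 ≤ p) (Nb : ℝ) :
    ((2 : ℝ) ^ (d * k - 1 - (d - 1))) ^ (2 * p - 1 - ((t : ℕ) + 1)) * Nb / klLevUnitF β M t p (d * k - 1) =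
      (((2 : ℝ) ^ (p + (t : ℕ) - klLevGain t - 3))⁻¹) ^ (d * (k - 1)) * (Nb / klLevUnitF β M t p (d - 1)) := by
  have hu0 : 0 < klLevUnitF β M t p (d - 1) := klLevUnitF_pos hβ t p _
  have hr0 : 0 < klLevRatioF t p := klLevRatioF_pos t p
  have hdk : d * (k - 1) = d * k - d := by rw [Nat.mul_sub, Nat.mul_one]
  have hdle : d ≤ d * k := Nat.le_mul_of_pos_right d (by omega)
  have hΔ : d * k - 1 - (d - 1) = d * (k - 1) := by omega
  have hsplit : d * k - 1 = (d - 1) + d * (k - 1) := by omega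
  rw [hΔ, hsplit, klLevUnitF_add, show 2 * p - 1 - ((t : ℕ) + 1) = 2 * p - 2 - (t : ℕ) by omega, ← pow_mul,
    mul_comm (d * (k - 1)), pow_mul, ← jump_div_klLevRatioF_eq t h1 h3, div_pow]
  field_simp

/-! ## §3 The re-based levelled re-measurement row in floor kit units -/

omit [NeZero L] [NeZero M] in
/-- **THE RE-BASED `hμ` SUMMANDS OF THE LEVELLED TRACK IN FLOOR KIT UNITS** (`d ≥ 2`, `k ≥ 2`, `t + 2 ≤ 2p`, `3 ≤ p`, base bound `N_b` at `F_{d−1}`):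
`klTowerMuLevAtF … d t k p ≤ 27^{t+1}·C₁·C₂^{2p−1}·( ((2^{e_F})⁻¹)^{d(k−1)}·N_b/unitF_t(p,d−1) + Σ_{1≤k′<k} 2^{e_F}·((2^d)⁻¹)^{e_F(k−k′)}·klTowerBLevF … d t (k′+1) p )`,
`e_F = p + t − klLevGain t − 3`. [cite: BenfattoGiulianiMastropietro2006, §2.8 (2.83), (2.93)-(2.98)] -/
theorem klTowerMuLevAtF_le_kitSum_base :
    ∃ C₁ C₂ : ℝ, 0 < C₁ ∧ 0 < C₂ ∧ ∀ R : RenConsts, R.WF2 → ∃ c₃' : ℝ, 0 < c₃' ∧ ∃ U₀' : ℝ, 0 < U₀' ∧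
      ∀ (P : SplitConsts) (c : ℝ), P.WF → 0 < c → c ≤ klEngC₃6 P R → c ≤ c₃' →
      ∀ μ ∈ klWindowC, ∀ U : ℝ, 0 < U → U ≤ klEngU₀9 P R c → U ≤ U₀' → ∀ β : ℝ, klBetaMin ≤ β → β ≤ Real.exp (c / U ^ 2) →
      ∀ K : TrigPolyC4v, FrameOK R U (nScales β) μ K → ∀ (L M : ℕ) [NeZero L] [NeZero M],
      klEngL₃ β U ≤ L → klEngM₃ β U L ≤ M → ∀ d k : ℕ, 2 ≤ d → 2 ≤ k → d * k - 1 ≤ nScales β + 1 →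
      ∀ (t : Fin 5) (p : ℕ), (t : ℕ) + 2 ≤ 2 * p → 3 ≤ p → ∀ Nb : ℝ, 0 ≤ Nb →
        (∀ Ωe' : Fin (2 * p) → Option (SectorLeg (sectorCount (d - 1))), levelCount Ωe' = (t : ℕ) + 1 →
          klLevNormOf L M β μ K (d - 1) (2 * p) (klTowerInput L M β U μ K d 1) Ωe' ≤ Nb) →
        klTowerMuLevAtF L M β U μ K d t k p ≤
          (27 : ℝ) ^ ((t : ℕ) + 1) * (C₁ * C₂ ^ (2 * p - 1)) *
            ((((2 : ℝ) ^ (p + (t : ℕ) - klLevGain t - 3))⁻¹) ^ (d * (k - 1)) * (Nb / klLevUnitF β M t p (d - 1)) +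
              ∑ k' ∈ Ico 1 k, (2 : ℝ) ^ (p + (t : ℕ) - klLevGain t - 3) *
                (((2 : ℝ) ^ d)⁻¹) ^ ((p + (t : ℕ) - klLevGain t - 3) * (k - k')) * klTowerBLevF L M β U μ K d t (k' + 1) p) := by
  obtain ⟨C₁, C₂, hC₁, hC₂, h⟩ := klTowerMeasLev_le_base_add_sum_bornLev_klEng_uniform
  refine ⟨C₁, C₂, hC₁, hC₂, fun R hR2 => ?_⟩
  obtain ⟨c₃, hc₃, U₀, hU₀, h'⟩ := h R hR2
  refine ⟨c₃, hc₃, U₀, hU₀, ?_⟩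
  intro P c hP hc hc6 hc₃' μ hμ U hU hU9 hU₀' β hβmin hβc K hK L M _ _ hL3 hM3 d k hd hk2 hkN t p h1 h3 Nb hN0 hN
  have hβ : 0 < β := KLRegimeSplit.pos_of_klBetaMin_le hβmin
  have hu : 0 < klLevUnitF β M t p (d * k - 1) := klLevUnitF_pos hβ t p _
  set e : ℕ := p + (t : ℕ) - klLevGain t - 3 with he
  have hN' : ∀ Ωe' : Fin (2 * p - 1 + 1) → Option (SectorLeg (sectorCount (d - 1))), levelCount Ωe' = (t : ℕ) + 1 →
      klLevNormOf L M β μ K (d - 1) (2 * p - 1 + 1) (klTowerInput L M β U μ K d 1) Ωe' ≤ Nb := by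
    rw [show 2 * p - 1 + 1 = 2 * p by omega]; exact hN
  have hrow := h' (2 * p - 1) P c hP hc hc6 hc₃' μ hμ U hU hU9 hU₀' β hβmin hβc K hK L M hL3 hM3 d k hd hk2 hkN ((t : ℕ) + 1) Nb hN0 hN'
  rw [show 2 * p - 1 + 1 = 2 * p by omega] at hrow
  unfold klTowerMuLevAtF
  rw [div_le_iff₀ hu]
  have hborn : ∀ k' ∈ Ico 1 k, C₁ * C₂ ^ (2 * p - 1) * ((2 : ℝ) ^ (d * k - 1 - d * k')) ^ (2 * p - 1 - ((t : ℕ) + 1)) *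
      klTowerBornLev L M β U μ K d k' (2 * p) ((t : ℕ) + 1) =
      C₁ * C₂ ^ (2 * p - 1) * ((2 : ℝ) ^ e * (((2 : ℝ) ^ d)⁻¹) ^ (e * (k - k')) * klTowerBLevF L M β U μ K d t (k' + 1) p) *
        klLevUnitF β M t p (d * k - 1) := by
    intro k' hk'
    have hk'k : k' < k := (mem_Ico.1 hk').2
    have eq := bornSummandF_div_klLevUnitF_eq (L := L) (M := M) hβ U μ K (by omega : 1 ≤ d) hk'k t h1 h3 (p := p)
    rw [div_eq_iff hu.ne'] at eq
    rw [mul_assoc (C₁ * C₂ ^ (2 * p - 1)), mul_assoc (C₁ * C₂ ^ (2 * p - 1)), eq]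
  have hbs : C₁ * C₂ ^ (2 * p - 1) * ((2 : ℝ) ^ (d * k - 1 - (d - 1))) ^ (2 * p - 1 - ((t : ℕ) + 1)) * Nb =
      C₁ * C₂ ^ (2 * p - 1) * ((((2 : ℝ) ^ e)⁻¹) ^ (d * (k - 1)) * (Nb / klLevUnitF β M t p (d - 1))) * klLevUnitF β M t p (d * k - 1) := by
    have eq := baseSummandF_div_klLevUnitF_eq (M := M) hβ (d := d) (k := k) (by omega) (by omega) t h1 h3 Nb
    rw [div_eq_iff hu.ne'] at eq
    rw [mul_assoc (C₁ * C₂ ^ (2 * p - 1)), mul_assoc (C₁ * C₂ ^ (2 * p - 1)), eq]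
  rw [sum_congr rfl hborn, hbs, ← sum_mul] at hrow
  calc (27 : ℝ) ^ ((t : ℕ) + 1) * klTowerMeasLev L M β U μ K d k (2 * p) ((t : ℕ) + 1)
      ≤ (27 : ℝ) ^ ((t : ℕ) + 1) * ((C₁ * C₂ ^ (2 * p - 1) * ((((2 : ℝ) ^ e)⁻¹) ^ (d * (k - 1)) * (Nb / klLevUnitF β M t p (d - 1))) +
          ∑ k' ∈ Ico 1 k, C₁ * C₂ ^ (2 * p - 1) * ((2 : ℝ) ^ e * (((2 : ℝ) ^ d)⁻¹) ^ (e * (k - k')) *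
            klTowerBLevF L M β U μ K d t (k' + 1) p)) * klLevUnitF β M t p (d * k - 1)) := by
        refine mul_le_mul_of_nonneg_left ?_ (by positivity)
        rw [add_mul]; exact hrow
    _ = (27 : ℝ) ^ ((t : ℕ) + 1) * (C₁ * C₂ ^ (2 * p - 1)) *
          ((((2 : ℝ) ^ e)⁻¹) ^ (d * (k - 1)) * (Nb / klLevUnitF β M t p (d - 1)) +
            ∑ k' ∈ Ico 1 k, (2 : ℝ) ^ e * (((2 : ℝ) ^ d)⁻¹) ^ (e * (k - k')) * klTowerBLevF L M β U μ K d t (k' + 1) p) *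
          klLevUnitF β M t p (d * k - 1) := by
        rw [← mul_sum]; ring

end Summit.HubbardSuperconductivity.HubbardSuperconductivity.Theorems.EngineV8

end
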